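import Literature.Barriers.CriticalPhenomena.RigorousRGSmallParameterLocOperator
import HarnessLib

/-!
# `RigorousRGSmallParameter` (Slade, Theorem 1.4.1): translation covariance of the localisation
# operator — Proposition 1.4.3 of [BS-rg-loc] for translations

Companion ("proof architecture") file of
`Literature/Barriers/CriticalPhenomena/RigorousRGSmallParameter.lean`, continuing `…LocOperator`
(`Loc_X`, Definition 1.3.2 of [BS-rg-loc]). Proposition 1.4.3 of [BS-rg-loc] states the
Euclidean covariance `E(Loc_X F) = Loc_{EX}(EF)` for automorphisms `E` of the torus, acting on
`𝒩` by `(EF)(φ) = F(φ_E)`, `(φ_E)_x = φ_{Ex}`; Slade §4.3 uses its translation case ("by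
translation invariance, `P_j(V)_x` does define a local polynomial with coefficients independent
of `x`"). This file proves the translation case `E = E_v : x ↦ x + v` for the concrete model
(fields `Λ_N → ℝⁿ` on the torus `TorusSite d M`), exactly (no patch hypotheses: translations
preserve the coordinates, `z^{(a+v)}(y+v) = z^{(a)}(y)`), with the base point of the dual test
functions translated along: **`transN_locX`**:
`E_v(Loc_X^{(a)} F) = Loc_{X+v}^{(a+v)}(E_v F)`.
On the way: the action of `E_v` on fields (`shiftField`, a continuous linear map), on `𝒩`
(`transN`), on coefficients (`coeff_transN`: `(EF)_{z+v} = E(F_z)`, the display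
`(EF)_{x,y}(φ) = F_{E⁻¹x,E⁻¹y}(φ_E)` of the proof of Proposition 1.4.3) and on pairings
(`TphiPairing_transN_zero`: `⟨EF, g⟩_0 = ⟨F, E^*g⟩_0`), and the covariance of the monomials
`E_v M_{m,x} = M_{m,x+v}`, of `P̂_m(X)`, of the dual test functions, of `α` and of `B`.

Sources: D. C. Brydges, G. Slade, *A renormalisation group method. II. Approximation by local
polynomials*, J. Stat. Phys. 159 (2015) 461–491, arXiv:1403.7253 (§1.4: the action of
automorphisms on `𝒩`, Proposition 1.4.3 and its proof); G. Slade, arXiv:1611.06169, §4.3 (the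
sentence after (4.14)).

## What this file provides (definitions with proved properties; no named fact)

* `shiftField`, `shiftField_apply`, **`transN`**, `contDiff_transN`, `shiftField_basisDir`,
  `dirDeriv_transN`, `shiftSeq`, **`coeff_transN`**, `sumSeq_shiftSeq`,
  **`TphiPairing_transN_zero`**.
* **`transN_monomial`**, `transN_phatX`, `coord_add`, `dualC_add`, `alphaVec_transN`,
  `Bmat_transN`, **`transN_locX`** (Proposition 1.4.3 for translations).

## References

* [BrydgesSlade2015RGII] D. C. Brydges, G. Slade, *A renormalisation group method. II.
  Approximation by local polynomials*, J. Stat. Phys. 159 (2015) 461–491, arXiv:1403.7253 —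
  §1.4 (Proposition 1.4.3).
* [Slade2017] G. Slade, *Critical exponents for long-range O(n) models below the upper critical
  dimension*, Commun. Math. Phys. 358 (2018) 343–436, arXiv:1611.06169 — §4.3.
-/

noncomputable section

namespace Literature.Barriers.CriticalPhenomena

namespace LongRangePhi4

namespace Loc

open Finset Tphi RGNorm LocalPoly Polymer Literature.Probability.LatticeModels Matrix
open scoped ContDiff

variable {d M n : ℕ} [NeZero M]

/-! ### Translations acting on fields, on `𝒩`, and on test functions -/

/-- The translated field `(φ_E)_x = φ_{x+v}` for the translation `E = E_v : x ↦ x + v`, as a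
continuous linear map of the field. [cite: BrydgesSlade2015RGII, §1.4 ("(φ_E)_x = φ_{Ex}")] -/
def shiftField (v : TorusSite d M) : (TorusSite d M → Fin n → ℝ) →L[ℝ] (TorusSite d M → Fin n → ℝ) :=
  { toFun := fun φ x => φ (x + v)
    map_add' := fun _ _ => rfl
    map_smul' := fun _ _ => rfl
    cont := continuous_pi fun x => continuous_apply (x + v) }

omit [NeZero M] in
/-- `(φ_E)_x = φ_{x+v}`. [folklore] -/
@[simp] theorem shiftField_apply (v : TorusSite d M) (φ : TorusSite d M → Fin n → ℝ) (x : TorusSite d M) :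
    shiftField v φ x = φ (x + v) := rfl

/-- **The action of the translation `E_v` on `𝒩`**: `(EF)(φ) = F(φ_E)`. [cite: BrydgesSlade2015RGII, §1.4 (display defining (EF)(φ), bosonic part)] -/
def transN (v : TorusSite d M) (F : (TorusSite d M → Fin n → ℝ) → ℝ) : (TorusSite d M → Fin n → ℝ) → ℝ :=
  fun φ => F (shiftField v φ)

/-- `EF` is smooth for smooth `F`. [folklore] -/
theorem contDiff_transN (v : TorusSite d M) {F : (TorusSite d M → Fin n → ℝ) → ℝ} (hF : ContDiff ℝ ∞ F) :
    ContDiff ℝ ∞ (transN v F) :=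
  hF.comp (shiftField v).contDiff

omit [NeZero M] in
/-- The translation of a coordinate direction: `(e_{(y,i)})_E = e_{(y-v,i)}`. [folklore] -/
theorem shiftField_basisDir (v : TorusSite d M) (y : TorusSite d M × Fin n) :
    shiftField v (basisDir d M n y) = basisDir d M n (y.1 - v, y.2) := by
  funext x i
  simp only [shiftField_apply, basisDir_apply]
  have : (x + v = y.1) ↔ (x = y.1 - v) := by
    constructor
    · intro h; rw [← h, add_sub_cancel_right]
    · intro h; rw [h, sub_add_cancel]
  simp only [this]

/-- **Directional derivatives of `EF`**: `∂_{e_y}(EF) = E(∂_{e_{y-v}}F)`. [folklore] -/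
theorem dirDeriv_transN (v : TorusSite d M) {F : (TorusSite d M → Fin n → ℝ) → ℝ} (hF : Differentiable ℝ F)
    (y : TorusSite d M × Fin n) :
    Tphi.dirDeriv (basisDir d M n y) (transN v F) = transN v (Tphi.dirDeriv (basisDir d M n (y.1 - v, y.2)) F) := by
  funext φ
  unfold Tphi.dirDeriv transN
  have h : HasFDerivAt (fun ψ => F (shiftField v ψ)) ((fderiv ℝ F (shiftField v φ)).comp (shiftField v)) φ :=
    (hF (shiftField v φ)).hasFDerivAt.comp φ (shiftField v).hasFDerivAt
  rw [h.fderiv, ContinuousLinearMap.comp_apply, shiftField_basisDir]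

/-- Translate every point of a sequence of field labels. [folklore] -/
def shiftSeq (v : TorusSite d M) (z : List (TorusSite d M × Fin n)) : List (TorusSite d M × Fin n) :=
  z.map fun y => (y.1 + v, y.2)

omit [NeZero M] in
/-- `shiftSeq` preserves the length. [folklore] -/
@[simp] theorem length_shiftSeq (v : TorusSite d M) (z : List (TorusSite d M × Fin n)) :
    (shiftSeq v z).length = z.length := by simp [shiftSeq]

/-- **The coefficients of `EF`**: `(EF)_z(φ) = F_{z - v}(φ_E)`, i.e. `(EF)_{z+v} = E(F_z)`. [cite: BrydgesSlade2015RGII, §1.4 (display (EF)_{x,y}(φ) = F_{E^{-1}x,E^{-1}y}(φ_E) in the proof of Proposition 1.4.3)] -/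
theorem coeff_transN (v : TorusSite d M) {F : (TorusSite d M → Fin n → ℝ) → ℝ} (hF : ContDiff ℝ ∞ F) :
    ∀ z : List (TorusSite d M × Fin n),
      coeff (basisDir d M n) (shiftSeq v z) (transN v F) = transN v (coeff (basisDir d M n) z F)
  | [] => rfl
  | y :: z => by
      rw [shiftSeq, List.map_cons, coeff_cons, ← shiftSeq, coeff_transN v hF z,
        dirDeriv_transN v (differentiable_of_contDiff (contDiff_coeff _ hF z)), coeff_cons]
      simp

omit [NeZero M] in
/-- `Σ_{|z|=r} f(z + v) = Σ_{|z|=r} f(z)`: translation is a bijection of sequences. [folklore] -/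
theorem sumSeq_shiftSeq [Fintype (TorusSite d M)] {N : Type*} [AddCommMonoid N] (v : TorusSite d M) :
    ∀ (r : ℕ) (f : List (TorusSite d M × Fin n) → N), sumSeq r (fun z => f (shiftSeq v z)) = sumSeq r f
  | 0, f => by simp [shiftSeq]
  | r + 1, f => by
      rw [sumSeq_succ, sumSeq_succ]
      have h : ∀ y : TorusSite d M × Fin n, sumSeq r (fun z => f (shiftSeq v (y :: z))) =
          sumSeq r (fun z => f ((y.1 + v, y.2) :: z)) := by
        intro y
        exact sumSeq_shiftSeq v r (fun z => f ((y.1 + v, y.2) :: z))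
      simp only [h]
      exact Fintype.sum_equiv ((Equiv.addRight v).prodCongr (Equiv.refl (Fin n))) _ _ fun y => rfl

/-- **`⟨EF, g⟩_0 = ⟨F, E^*g⟩_0`** with `(E^*g)_z = g_{Ez}` (display (Epair) of [BS-rg-loc], at zero
field; `φ_E = 0` for `φ = 0`). [cite: BrydgesSlade2015RGII, Proposition 1.4.3 (proof, display ⟨EF,g⟩_φ = ⟨F,E^*g⟩_{φ_E})] -/
theorem TphiPairing_transN_zero (pN : ℕ) (v : TorusSite d M) {F : (TorusSite d M → Fin n → ℝ) → ℝ}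
    (hF : ContDiff ℝ ∞ F) (g : List (TorusSite d M × Fin n) → ℝ) :
    TphiPairing pN (basisDir d M n) (transN v F) 0 g = TphiPairing pN (basisDir d M n) F 0 (fun z => g (shiftSeq v z)) := by
  unfold TphiPairing pairing
  refine Finset.sum_congr rfl fun r _ => ?_
  congr 1
  rw [← sumSeq_shiftSeq v r (fun z => coeffFamily (basisDir d M n) (transN v F) 0 z * g z)]
  refine sumSeq_congr r fun z _ => ?_
  simp only [coeffFamily]
  rw [coeff_transN v hF z]
  simp [transN]

/-! ### Translation covariance of the monomials, of `P̂`, of the dual test functions -/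

/-- `E_v M_{m,x} = M_{m,x+v}`. [cite: BrydgesSlade2015RGII, §1.2 ("V_∅ is Euclidean covariant: E(V_{∅,x}) = V_{∅,Ex}") via Proposition 1.4.3] -/
theorem transN_monomial (v : TorusSite d M) (m : List (Fin n × List (Fin d × Bool))) (x : TorusSite d M) :
    transN v (monomial m x) = monomial m (x + v) := by
  funext φ
  unfold transN monomial
  congr 1
  refine List.map_congr_left fun c _ => ?_
  rw [dfield_apply, dfield_apply]
  -- `∇^α (φ_E)^i_x = ∇^α φ^i_{x+v}`
  suffices h : ∀ (l : List (TorusSite d M)) (x : TorusSite d M),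
      fdiffs l (fun y => shiftField v φ y c.1) x = fdiffs l (fun y => φ y c.1) (x + v) from h _ x
  intro l
  induction l with
  | nil => intro x; simp
  | cons s l ih => intro x; simp only [fdiffs_cons, ih]; abel_nf

/-- `E_v P̂_m(X) = P̂_m(X + v)`. [folklore] -/
theorem transN_phatX (v : TorusSite d M) (m' : List (Fin n × List (Fin d))) (X : Finset (TorusSite d M)) :
    transN v (phatX m' X) = phatX m' (X.image (· + v)) := by
  funext φ
  simp only [transN, phatX, phat]
  rw [Finset.sum_image fun x _ y _ h => add_right_cancel h]
  refine Finset.sum_congr rfl fun x _ => ?_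
  congr 1
  refine Finset.sum_congr rfl fun S _ => ?_
  have h := congrFun (transN_monomial v (flipM S (m'.map fwd)) x) φ
  simp only [transN] at h
  rw [h]

omit [NeZero M] in
/-- Coordinates are translation invariant: `z^{(a+v)}(y+v) = z^{(a)}(y)`. [folklore] -/
theorem coord_add (a v y : TorusSite d M) (j : Fin d) : coord (a + v) (y + v) j = coord a y j := by
  simp [coord]

omit [NeZero M] in
/-- The dual test functions are translation covariant: `f^{(a+v)}_C(z + v) = f^{(a)}_C(z)`. [folklore] -/
theorem dualC_add (a v : TorusSite d M) (C : Multiset (Fin n × Multiset (Fin d)))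
    (z : List (TorusSite d M × Fin n)) : dualC (a + v) C (shiftSeq v z) = dualC a C z := by
  unfold dualC dualTF
  congr 1
  suffices h : ∀ (L : List (Fin n × List (Fin d))) (z : List (TorusSite d M × Fin n)),
      tensorTF (L.map (binomTF (a + v))) (shiftSeq v z) = tensorTF (L.map (binomTF a)) z from h _ z
  intro L
  induction L with
  | nil => intro z; cases z <;> simp [shiftSeq, tensorTF]
  | cons c L ih =>
      intro z
      cases z with
      | nil => simp [shiftSeq, tensorTF]
      | cons y z =>
          have hs : shiftSeq v (y :: z) = (y.1 + v, y.2) :: shiftSeq v z := rfl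
          rw [hs, List.map_cons, List.map_cons, tensorTF_cons_cons, tensorTF_cons_cons, ih]
          simp [binomTF, coord_add]

/-! ### Proposition 1.4.3 for translations: `E(Loc_X F) = Loc_{EX}(EF)` -/

/-- The row vector is translation invariant: `α^{(a+v)}(E_vF) = α^{(a)}(F)`. [folklore] -/
theorem alphaVec_transN (pN : ℕ) (dφ dplus : ℝ) (a v : TorusSite d M) {F : (TorusSite d M → Fin n → ℝ) → ℝ}
    (hF : ContDiff ℝ ∞ F) : alphaVec (n := n) pN dφ dplus (a + v) (transN v F) = alphaVec pN dφ dplus a F := by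
  funext C
  unfold alphaVec
  rw [TphiPairing_transN_zero pN v hF]
  simp only [dualC_add]

/-- The matrix `B` is translation invariant. [folklore] -/
theorem Bmat_transN (pN : ℕ) (dφ dplus : ℝ) (a v : TorusSite d M) (X : Finset (TorusSite d M)) :
    Bmat (n := n) pN dφ dplus (a + v) (X.image (· + v)) = Bmat pN dφ dplus a X := by
  ext C' C
  simp only [Bmat, Matrix.of_apply]
  rw [← transN_phatX v, TphiPairing_transN_zero pN v (contDiff_phatX _ X)]
  simp only [dualC_add]

/-- **Proposition 1.4.3 of [BS-rg-loc] for translations**: `E_v(Loc_X F) = Loc_{X+v}(E_v F)` (with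
the base point translated along). [cite: BrydgesSlade2015RGII, Proposition 1.4.3] -/
theorem transN_locX (pN : ℕ) (dφ dplus : ℝ) (a v : TorusSite d M) (X : Finset (TorusSite d M))
    {F : (TorusSite d M → Fin n → ℝ) → ℝ} (hF : ContDiff ℝ ∞ F) :
    transN v (locX pN dφ dplus a X F) = locX pN dφ dplus (a + v) (X.image (· + v)) (transN v F) := by
  funext φ
  unfold locX betaVec
  rw [alphaVec_transN pN dφ dplus a v hF, Bmat_transN]
  simp only [transN]
  refine Finset.sum_congr rfl fun C _ => ?_
  have h := congrFun (transN_phatX v (rep C.1) X) φ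
  simp only [transN] at h
  rw [h]

end Loc

end LongRangePhi4

end Literature.Barriers.CriticalPhenomena

end
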